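import Summits.AtomisticToContinuum.Crystallization.Theorems.ExcessDecayLiouvilleHcpLiouvilleBlowdownDefs

/-!
# `ExcessDecayLiouville.HcpLiouville` (stmt-AtomisticToContinuum-9332), line `Sketch` v4: `ℓ²` bookkeeping for the Green's operator

Part H3a of stub `stub_green` (the lattice Green's operator `L⁻¹ div : ℓ^{1,1} → ℓ²`), lead file.  The `ℓ²` bound of
`stub_green` is obtained by decomposing the right-hand side into countably many DIPOLES and summing the responses; this
file provides the two pieces of pure bookkeeping used there:

* `Blowdown.norm_sum_sq_le_weighted`, `Blowdown.sum_norm_sq_le_sq_of_parts`, `Blowdown.tsum_norm_sq_le_of_hasSum` —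
  the weighted Cauchy–Schwarz inequality `Σ_x ‖Σ_n h_n x‖² ≤ (Σ_n β_n)²` whenever `Σ_x ‖h_n x‖² ≤ β_n²`
  (countable Minkowski in `ℓ²` without square roots of series);
* `Blowdown.adm_*` — elementary calculus of ADMISSIBLE right-hand sides `f` of the solution operator, i.e. fields with
  `|Σ'_{p ∈ S} ⟪f p, w p⟫| ≤ N · √(nnForm w)` for all finitely supported test fields `w` on the sites `S`
  (sums, scalar multiples, monotonicity in `N`, point forces under a capacity inequality, dipoles under a path bound).

All `[folklore]`; a `--supports` helper for item stmt-AtomisticToContinuum-9332, nothing here closes an item.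
-/

noncomputable section

namespace Summit.AtomisticToContinuum.Crystallization.Theorems.ExcessDecayLiouville

open scoped BigOperators Topology Classical InnerProductSpace RealInnerProductSpace
open Literature.MathematicalPhysics.StatisticalMechanics
open Summit.AtomisticToContinuum.Crystallization.Theses.ExcessDecayLiouville
open Summit.AtomisticToContinuum.Crystallization.Theorems.PhononStabilityNegative

namespace Blowdown

/-! ## Weighted Cauchy–Schwarz in `ℓ²` -/

/-- **Weighted Cauchy–Schwarz for a finite sum of vectors**: for positive weights `β`,
`‖Σ_{n∈I} h n‖² ≤ (Σ_{n∈I} β n) · Σ_{n∈I} ‖h n‖² / β n`. [folklore] -/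
theorem norm_sum_sq_le_weighted {ι V : Type*} [NormedAddCommGroup V] (I : Finset ι) (h : ι → V) (β : ι → ℝ)
    (hβ : ∀ n ∈ I, 0 < β n) :
    ‖∑ n ∈ I, h n‖ ^ 2 ≤ (∑ n ∈ I, β n) * ∑ n ∈ I, ‖h n‖ ^ 2 / β n := by
  have h1 : ‖∑ n ∈ I, h n‖ ≤ ∑ n ∈ I, Real.sqrt (β n) * (‖h n‖ / Real.sqrt (β n)) := by
    refine (norm_sum_le _ _).trans (le_of_eq (Finset.sum_congr rfl fun n hn => ?_))
    rw [mul_div_cancel₀ _ (Real.sqrt_pos.2 (hβ n hn)).ne']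
  have h2 := Finset.sum_mul_sq_le_sq_mul_sq I (fun n => Real.sqrt (β n)) (fun n => ‖h n‖ / Real.sqrt (β n))
  have h3 : ∑ n ∈ I, Real.sqrt (β n) ^ 2 = ∑ n ∈ I, β n :=
    Finset.sum_congr rfl fun n hn => Real.sq_sqrt (hβ n hn).le
  have h4 : ∑ n ∈ I, (‖h n‖ / Real.sqrt (β n)) ^ 2 = ∑ n ∈ I, ‖h n‖ ^ 2 / β n :=
    Finset.sum_congr rfl fun n hn => by rw [div_pow, Real.sq_sqrt (hβ n hn).le]
  rw [h3, h4] at h2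
  have h0 : 0 ≤ ∑ n ∈ I, Real.sqrt (β n) * (‖h n‖ / Real.sqrt (β n)) :=
    Finset.sum_nonneg fun n _ => by positivity
  calc ‖∑ n ∈ I, h n‖ ^ 2 ≤ (∑ n ∈ I, Real.sqrt (β n) * (‖h n‖ / Real.sqrt (β n))) ^ 2 :=
        pow_le_pow_left₀ (norm_nonneg _) h1 2
    _ ≤ _ := h2

/-- **Finite form of the countable Minkowski inequality**: if `Σ_{x∈U} ‖h n x‖² ≤ β_n²` with `β_n ≥ 0` for every
`n ∈ I`, then `Σ_{x∈U} ‖Σ_{n∈I} h n x‖² ≤ (Σ_{n∈I} β n)²`. [folklore] -/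
theorem sum_norm_sq_le_sq_of_parts {ι α V : Type*} [NormedAddCommGroup V] (I : Finset ι) (U : Finset α)
    (h : ι → α → V) (β : ι → ℝ) (hβ : ∀ n ∈ I, 0 ≤ β n)
    (hh : ∀ n ∈ I, ∑ x ∈ U, ‖h n x‖ ^ 2 ≤ β n ^ 2) :
    ∑ x ∈ U, ‖∑ n ∈ I, h n x‖ ^ 2 ≤ (∑ n ∈ I, β n) ^ 2 := by
  classical
  -- indices with `β n = 0` contribute nothing
  set I' := I.filter fun n => β n ≠ 0 with hI'
  have hzero : ∀ n ∈ I, β n = 0 → ∀ x ∈ U, h n x = 0 := by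
    intro n hn hb x hx
    have h1 := hh n hn
    rw [hb, zero_pow two_ne_zero] at h1
    have h2 : ‖h n x‖ ^ 2 ≤ ∑ y ∈ U, ‖h n y‖ ^ 2 :=
      Finset.single_le_sum (fun y _ => sq_nonneg ‖h n y‖) hx
    have h3 : ‖h n x‖ ^ 2 = 0 := le_antisymm (h2.trans h1) (sq_nonneg _)
    exact norm_eq_zero.1 (pow_eq_zero_iff two_ne_zero |>.1 h3)
  have hsumI : ∀ x ∈ U, ∑ n ∈ I, h n x = ∑ n ∈ I', h n x := by
    intro x hx
    rw [hI', Finset.sum_filter]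
    refine Finset.sum_congr rfl fun n hn => ?_
    by_cases hb : β n ≠ 0
    · rw [if_pos hb]
    · rw [if_neg hb, hzero n hn (not_not.1 hb) x hx]
  have hpos : ∀ n ∈ I', 0 < β n := fun n hn => by
    rw [hI', Finset.mem_filter] at hn
    exact lt_of_le_of_ne (hβ n hn.1) (Ne.symm hn.2)
  have hsub : I' ⊆ I := Finset.filter_subset _ _
  -- weighted Cauchy–Schwarz at every `x`, then exchange the sums
  calc ∑ x ∈ U, ‖∑ n ∈ I, h n x‖ ^ 2 = ∑ x ∈ U, ‖∑ n ∈ I', h n x‖ ^ 2 :=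
        Finset.sum_congr rfl fun x hx => by rw [hsumI x hx]
    _ ≤ ∑ x ∈ U, (∑ n ∈ I', β n) * ∑ n ∈ I', ‖h n x‖ ^ 2 / β n :=
        Finset.sum_le_sum fun x _ => norm_sum_sq_le_weighted I' (fun n => h n x) β hpos
    _ = (∑ n ∈ I', β n) * ∑ n ∈ I', (∑ x ∈ U, ‖h n x‖ ^ 2) / β n := by
        rw [← Finset.mul_sum, Finset.sum_comm]
        congr 1
        refine Finset.sum_congr rfl fun n _ => ?_
        rw [Finset.sum_div]
    _ ≤ (∑ n ∈ I', β n) * ∑ n ∈ I', β n := by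
        refine mul_le_mul_of_nonneg_left (Finset.sum_le_sum fun n hn => ?_)
          (Finset.sum_nonneg fun n hn => (hpos n hn).le)
        rw [div_le_iff₀ (hpos n hn), ← sq]
        exact hh n (hsub hn)
    _ = (∑ n ∈ I', β n) ^ 2 := (sq _).symm
    _ ≤ (∑ n ∈ I, β n) ^ 2 :=
        pow_le_pow_left₀ (Finset.sum_nonneg fun n hn => (hpos n hn).le)
          (Finset.sum_le_sum_of_subset_of_nonneg hsub fun n hn _ => hβ n hn) 2

/-- **Countable Minkowski inequality in `ℓ²` (squared form)**: if `H = Σ_n h n` pointwise, every `h n` is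
square-summable with `Σ' ‖h n x‖² ≤ β_n²`, `β ≥ 0` summable, then `H` is square-summable with
`Σ' ‖H x‖² ≤ (Σ' β)²`. [folklore] -/
theorem tsum_norm_sq_le_of_hasSum {ι α V : Type*} [NormedAddCommGroup V] (h : ι → α → V) (H : α → V)
    (β : ι → ℝ) (hβ : ∀ n, 0 ≤ β n) (hB : Summable β)
    (hh : ∀ n, Summable (fun x => ‖h n x‖ ^ 2) ∧ ∑' x, ‖h n x‖ ^ 2 ≤ β n ^ 2)
    (hH : ∀ x, HasSum (fun n => h n x) (H x)) :
    Summable (fun x => ‖H x‖ ^ 2) ∧ ∑' x, ‖H x‖ ^ 2 ≤ (∑' n, β n) ^ 2 := by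
  classical
  -- every finite partial sum is bounded by `(Σ' β)²`
  have hU : ∀ U : Finset α, ∑ x ∈ U, ‖H x‖ ^ 2 ≤ (∑' n, β n) ^ 2 := by
    intro U
    -- the partial sums in `n` converge, for each of the finitely many `x ∈ U`
    have hlim : Filter.Tendsto (fun I : Finset ι => ∑ x ∈ U, ‖∑ n ∈ I, h n x‖ ^ 2) Filter.atTop
        (𝓝 (∑ x ∈ U, ‖H x‖ ^ 2)) :=
      tendsto_finsetSum U fun x _ => ((hH x).norm.pow 2)
    refine le_of_tendsto' hlim fun I => ?_
    refine (sum_norm_sq_le_sq_of_parts I U h β (fun n _ => hβ n) fun n _ => ?_).trans ?_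
    · exact ((hh n).1.sum_le_tsum U (fun x _ => sq_nonneg _)).trans (hh n).2
    · exact pow_le_pow_left₀ (Finset.sum_nonneg fun n _ => hβ n) (hB.sum_le_tsum I (fun n _ => hβ n)) 2
  have hs : Summable (fun x => ‖H x‖ ^ 2) := summable_of_sum_le (fun x => sq_nonneg _) hU
  exact ⟨hs, hs.tsum_le_of_sum_le hU⟩


/-- Registered sub-goal carrying this file (crux stmt-AtomisticToContinuum-9332, line `Sketch` v4, part H3a of
`stub_green`): the countable Minkowski inequality in `ℓ²`, squared form, for `ℝ³`-valued families. [folklore] -/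
theorem _root_.Summit.AtomisticToContinuum.Crystallization.Theorems.ExcessDecayLiouville.blowdown_greenL2 :
    ∀ (ι α : Type) (h : ι → α → EuclideanSpace ℝ (Fin 3)) (H : α → EuclideanSpace ℝ (Fin 3)) (β : ι → ℝ),
      (∀ n, 0 ≤ β n) → Summable β →
      (∀ n, Summable (fun x => ‖h n x‖ ^ 2) ∧ ∑' x, ‖h n x‖ ^ 2 ≤ β n ^ 2) →
      (∀ x, HasSum (fun n => h n x) (H x)) →
        Summable (fun x => ‖H x‖ ^ 2) ∧ ∑' x, ‖H x‖ ^ 2 ≤ (∑' n, β n) ^ 2 :=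
  fun _ _ h H β hβ hB hh hH => tsum_norm_sq_le_of_hasSum h H β hβ hB hh hH

/-- **Squared form of the triangle inequality for `n` summands**: `‖Σ_{s<n} g s‖² ≤ n · Σ_{s<n} ‖g s‖²`. [folklore] -/
theorem norm_sum_range_sq_le {V : Type*} [NormedAddCommGroup V] (n : ℕ) (g : ℕ → V) :
    ‖∑ s ∈ Finset.range n, g s‖ ^ 2 ≤ n * ∑ s ∈ Finset.range n, ‖g s‖ ^ 2 := by
  have h1 : ‖∑ s ∈ Finset.range n, g s‖ ≤ ∑ s ∈ Finset.range n, ‖g s‖ := norm_sum_le _ _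
  have h2 := sq_sum_le_card_mul_sum_sq (s := Finset.range n) (f := fun s => ‖g s‖)
  rw [Finset.card_range] at h2
  exact (pow_le_pow_left₀ (norm_nonneg _) h1 2).trans h2

/-! ## Admissible right-hand sides -/

section Adm

variable {t : Fin 2 → EuclideanSpace ℝ (Fin 3)} {A : EuclideanSpace ℝ (Fin 3) →L[ℝ] EuclideanSpace ℝ (Fin 3)}

/-- The pairing `Σ'_{p ∈ S} ⟪f p, w p⟫` against a finitely supported test field is a finite sum: the family is
summable. [folklore] -/
theorem summable_pairing (f : EuclideanSpace ℝ (Fin 3) → EuclideanSpace ℝ (Fin 3))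
    {w : EuclideanSpace ℝ (Fin 3) → EuclideanSpace ℝ (Fin 3)} (hw : (Function.support w).Finite) :
    Summable (fun p : Sites₀ t A => ⟪f p, w p⟫) := by
  refine summable_of_hasFiniteSupport ((hw.preimage Subtype.val_injective.injOn).subset ?_)
  intro p hp
  simp only [Function.mem_support, ne_eq, Set.mem_preimage] at hp ⊢
  intro h
  exact hp (by rw [h, inner_zero_right])

/-- Additivity of the pairing in `f`. [folklore] -/
theorem pairing_add (f g : EuclideanSpace ℝ (Fin 3) → EuclideanSpace ℝ (Fin 3))
    {w : EuclideanSpace ℝ (Fin 3) → EuclideanSpace ℝ (Fin 3)} (hw : (Function.support w).Finite) :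
    ∑' p : Sites₀ t A, ⟪(f + g) p, w p⟫ = ∑' p : Sites₀ t A, ⟪f p, w p⟫ + ∑' p : Sites₀ t A, ⟪g p, w p⟫ := by
  rw [← (summable_pairing f hw).tsum_add (summable_pairing g hw)]
  exact tsum_congr fun p => by rw [Pi.add_apply, inner_add_left]

/-- Homogeneity of the pairing in `f`. [folklore] -/
theorem pairing_smul (c : ℝ) (f : EuclideanSpace ℝ (Fin 3) → EuclideanSpace ℝ (Fin 3))
    (w : EuclideanSpace ℝ (Fin 3) → EuclideanSpace ℝ (Fin 3)) :
    ∑' p : Sites₀ t A, ⟪(c • f) p, w p⟫ = c * ∑' p : Sites₀ t A, ⟪f p, w p⟫ := by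
  rw [← tsum_mul_left]
  exact tsum_congr fun p => by rw [Pi.smul_apply, inner_smul_left]; rfl

/-- **Admissible fields form a cone, I**: sums. [folklore] -/
theorem adm_add {f g : EuclideanSpace ℝ (Fin 3) → EuclideanSpace ℝ (Fin 3)} {Nf Ng : ℝ}
    (hf : ∀ w : EuclideanSpace ℝ (Fin 3) → EuclideanSpace ℝ (Fin 3), (Function.support w).Finite →
      Function.support w ⊆ Sites₀ t A → |∑' p : Sites₀ t A, ⟪f p, w p⟫| ≤ Nf * Real.sqrt (nnForm t A w))
    (hg : ∀ w : EuclideanSpace ℝ (Fin 3) → EuclideanSpace ℝ (Fin 3), (Function.support w).Finite →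
      Function.support w ⊆ Sites₀ t A → |∑' p : Sites₀ t A, ⟪g p, w p⟫| ≤ Ng * Real.sqrt (nnForm t A w)) :
    ∀ w : EuclideanSpace ℝ (Fin 3) → EuclideanSpace ℝ (Fin 3), (Function.support w).Finite →
      Function.support w ⊆ Sites₀ t A →
        |∑' p : Sites₀ t A, ⟪(f + g) p, w p⟫| ≤ (Nf + Ng) * Real.sqrt (nnForm t A w) := by
  intro w hw hwS
  rw [pairing_add f g hw, add_mul]
  exact (abs_add_le _ _).trans (add_le_add (hf w hw hwS) (hg w hw hwS))

/-- **Admissible fields form a cone, II**: scalar multiples. [folklore] -/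
theorem adm_smul {f : EuclideanSpace ℝ (Fin 3) → EuclideanSpace ℝ (Fin 3)} {Nf : ℝ} (c : ℝ)
    (hf : ∀ w : EuclideanSpace ℝ (Fin 3) → EuclideanSpace ℝ (Fin 3), (Function.support w).Finite →
      Function.support w ⊆ Sites₀ t A → |∑' p : Sites₀ t A, ⟪f p, w p⟫| ≤ Nf * Real.sqrt (nnForm t A w)) :
    ∀ w : EuclideanSpace ℝ (Fin 3) → EuclideanSpace ℝ (Fin 3), (Function.support w).Finite →
      Function.support w ⊆ Sites₀ t A →
        |∑' p : Sites₀ t A, ⟪(c • f) p, w p⟫| ≤ (|c| * Nf) * Real.sqrt (nnForm t A w) := by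
  intro w hw hwS
  rw [pairing_smul, abs_mul, mul_assoc]
  exact mul_le_mul_of_nonneg_left (hf w hw hwS) (abs_nonneg c)

/-- **Admissible fields, III**: the bound may be enlarged. [folklore] -/
theorem adm_mono {f : EuclideanSpace ℝ (Fin 3) → EuclideanSpace ℝ (Fin 3)} {Nf N' : ℝ} (hN : Nf ≤ N')
    (hf : ∀ w : EuclideanSpace ℝ (Fin 3) → EuclideanSpace ℝ (Fin 3), (Function.support w).Finite →
      Function.support w ⊆ Sites₀ t A → |∑' p : Sites₀ t A, ⟪f p, w p⟫| ≤ Nf * Real.sqrt (nnForm t A w)) :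
    ∀ w : EuclideanSpace ℝ (Fin 3) → EuclideanSpace ℝ (Fin 3), (Function.support w).Finite →
      Function.support w ⊆ Sites₀ t A →
        |∑' p : Sites₀ t A, ⟪f p, w p⟫| ≤ N' * Real.sqrt (nnForm t A w) :=
  fun w hw hwS => (hf w hw hwS).trans (mul_le_mul_of_nonneg_right hN (Real.sqrt_nonneg _))

/-- The pairing of a point force `δ_a ξ` is `⟪ξ, w a⟫`. [folklore] -/
theorem pairing_single {a : EuclideanSpace ℝ (Fin 3)} (ha : a ∈ Sites₀ t A) (ξ : EuclideanSpace ℝ (Fin 3))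
    (w : EuclideanSpace ℝ (Fin 3) → EuclideanSpace ℝ (Fin 3)) :
    ∑' p : Sites₀ t A, ⟪(if (p : EuclideanSpace ℝ (Fin 3)) = a then ξ else 0), w p⟫ = ⟪ξ, w a⟫ := by
  rw [tsum_eq_single (⟨a, ha⟩ : Sites₀ t A)]
  · simp
  · intro p hp
    have : (p : EuclideanSpace ℝ (Fin 3)) ≠ a := fun h => hp (Subtype.ext h)
    rw [if_neg this, inner_zero_left]

/-- **Point forces are admissible under a capacity inequality**: if `‖w p‖² ≤ C₁ · nnForm w` for finitely supported
`w`, then `δ_a ξ` is admissible with constant `√C₁ · ‖ξ‖`. [folklore] -/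
theorem adm_single {C₁ : ℝ}
    (hcap : ∀ w : EuclideanSpace ℝ (Fin 3) → EuclideanSpace ℝ (Fin 3), (Function.support w).Finite →
      Function.support w ⊆ Sites₀ t A → ∀ p ∈ Sites₀ t A, ‖w p‖ ^ 2 ≤ C₁ * nnForm t A w)
    {a : EuclideanSpace ℝ (Fin 3)} (ha : a ∈ Sites₀ t A) (ξ : EuclideanSpace ℝ (Fin 3)) :
    ∀ w : EuclideanSpace ℝ (Fin 3) → EuclideanSpace ℝ (Fin 3), (Function.support w).Finite →
      Function.support w ⊆ Sites₀ t A →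
        |∑' p : Sites₀ t A, ⟪(fun x => if x = a then ξ else 0) p, w p⟫| ≤
          (Real.sqrt C₁ * ‖ξ‖) * Real.sqrt (nnForm t A w) := by
  intro w hw hwS
  rw [pairing_single ha ξ w]
  have h1 := hcap w hw hwS a ha
  have h2 : ‖w a‖ ≤ Real.sqrt C₁ * Real.sqrt (nnForm t A w) := by
    rw [← Real.sqrt_mul' _ (nnForm_nonneg t A w), ← Real.sqrt_sq (norm_nonneg (w a))]
    exact Real.sqrt_le_sqrt h1
  calc |⟪ξ, w a⟫| ≤ ‖ξ‖ * ‖w a‖ := abs_real_inner_le_norm _ _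
    _ ≤ ‖ξ‖ * (Real.sqrt C₁ * Real.sqrt (nnForm t A w)) := mul_le_mul_of_nonneg_left h2 (norm_nonneg _)
    _ = Real.sqrt C₁ * ‖ξ‖ * Real.sqrt (nnForm t A w) := by ring

/-- **Dipoles are admissible under a path bound**: if `‖w p − w q‖ ≤ C₀ (1 + dist p q) √(nnForm w)` for finitely
supported `w`, then `(δ_p − δ_q) ξ` is admissible with constant `C₀ (1 + dist p q) ‖ξ‖`. [folklore] -/
theorem adm_dipole {C₀ : ℝ}
    (hpath : ∀ w : EuclideanSpace ℝ (Fin 3) → EuclideanSpace ℝ (Fin 3), (Function.support w).Finite →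
      Function.support w ⊆ Sites₀ t A → ∀ p ∈ Sites₀ t A, ∀ q ∈ Sites₀ t A,
        ‖w p - w q‖ ≤ C₀ * (1 + dist p q) * Real.sqrt (nnForm t A w))
    {p q : EuclideanSpace ℝ (Fin 3)} (hp : p ∈ Sites₀ t A) (hq : q ∈ Sites₀ t A) (ξ : EuclideanSpace ℝ (Fin 3)) :
    ∀ w : EuclideanSpace ℝ (Fin 3) → EuclideanSpace ℝ (Fin 3), (Function.support w).Finite →
      Function.support w ⊆ Sites₀ t A →
        |∑' x : Sites₀ t A, ⟪(fun x => (if x = p then ξ else 0) - (if x = q then ξ else 0)) x, w x⟫| ≤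
          (C₀ * (1 + dist p q) * ‖ξ‖) * Real.sqrt (nnForm t A w) := by
  intro w hw hwS
  have hsplit : (fun x : EuclideanSpace ℝ (Fin 3) => (if x = p then ξ else 0) - (if x = q then ξ else 0)) =
      (fun x => if x = p then ξ else 0) + (-1 : ℝ) • (fun x => if x = q then ξ else 0) := by
    funext x; simp [sub_eq_add_neg]
  rw [hsplit, pairing_add _ _ hw, pairing_smul, pairing_single hp, pairing_single hq, neg_one_mul, ← sub_eq_add_neg,
    ← inner_sub_right]
  calc |⟪ξ, w p - w q⟫| ≤ ‖ξ‖ * ‖w p - w q‖ := abs_real_inner_le_norm _ _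
    _ ≤ ‖ξ‖ * (C₀ * (1 + dist p q) * Real.sqrt (nnForm t A w)) :=
        mul_le_mul_of_nonneg_left (hpath w hw hwS p hp q hq) (norm_nonneg _)
    _ = C₀ * (1 + dist p q) * ‖ξ‖ * Real.sqrt (nnForm t A w) := by ring

end Adm

end Blowdown

end Summit.AtomisticToContinuum.Crystallization.Theorems.ExcessDecayLiouville

end
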